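import Summits.CriticalPhenomena.Ising3DConformalLimit.Theorems.EnergyNotSigmaSquaredGapForcesFarMergingScreeningDefs
import Literature.Probability.LatticeModels.SourcedDoubleCurrentsSwitchingProofs
import Literature.Probability.LatticeModels.CriticalUrsellFourSign
import Literature.Probability.LatticeModels.CriticalCorrWellDefined
import HarnessLib

/-! # Far screening is far merging (line `screening-form-lemma-a1` of crux `GapForcesFarMerging`,
item stmt-CriticalPhenomena-4468; stub `stub_farMerging`)

The exact far end of the line: `ScreeningIdentity → FarScreeningIO → FarMergingShape cc2 (criticalCorr 3 4)`.

Route. `FarScreeningIO` gives `c > 0`, an injective shape `y` and, for every `L₀`, a scale `L ≥ L₀` with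
mean screening `≤ 1 - c` for infinitely many box sizes `n`. For `n` large the dilated quadruple
`z = L • y` lies in `Λ_n = box 3 n`, so the screening dictionary `ScreeningIdentity` (ADC21 Lemma A.1)
turns this into `P^{z₀z₁,z₂z₃}_{Λ_n}[z₀ ↔ z₂] ≥ c` frequently in `n`. By ADC21 (3.11) in the box
(`connectedFour_free_box_eq`), `U₄^{Λ_n}(z) = -2 G_n(z₀,z₁) G_n(z₂,z₃) P_n ≤ -2c G_n G_n` frequently
(Griffiths I: `G_n ≥ 0`). The box quantities converge (`tendsto_connectedFour_box_criticalBeta`,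
`criticalCorr_wellDefined_holds`), and a convergent real sequence which is `≤ 0` frequently has limit
`≤ 0`; this is the far-merging inequality with constant `2c` along the shape `y`.

References: Aizenman–Duminil-Copin 2021, §3 (3.11)–(3.12), Appendix A Lemma A.1; Aizenman 1982 Prop. 5.3.
-/

noncomputable section

namespace Summit.CriticalPhenomena.Ising3DConformalLimit.EnergyNotSigmaSquaredGapForcesFarMerging

open scoped symmDiff ENNReal Topology
open MeasureTheory Filter Finset
open Literature.Probability.LatticeModels Literature.Probability.Percolation
open Summit.CriticalPhenomena.Ising3DConformalLimit.Theorems.GapForcesFarMerging.Negative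
  (e₁ e₂ cc2 xR up dn FarMergingShape)
open Summit.CriticalPhenomena.Ising3DConformalLimit.GapForcesFarMergingScreening

/-- The free-boundary box two-point function at `β_c(3)` converges to the critical pair correlator
`⟨σ_aσ_b⟩_{β_c}` as `Λ_n ↑ ℤ³` (`criticalCorr_wellDefined_holds`). [cite: FriedliVelenik2017, Thm. 3.17 and Lemma 3.23] -/
theorem tendsto_isingTwoPoint_box_criticalCorr_two (a b : Site 3) :
    Tendsto (fun n : ℕ => isingTwoPoint (zdGraph 3) (box 3 n) (criticalBeta 3) 0 .free a b) atTop
      (𝓝 (criticalCorr 3 2 ![a, b])) := by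
  have hmem : (BoundaryCondition.free : BoundaryCondition (Site 3)) ∈
      ({.free, .plus, .minus} : Set (BoundaryCondition (Site 3))) := by simp
  have h := criticalCorr_wellDefined_holds (d := 3) le_rfl 2 ![a, b] .free hmem
  refine Tendsto.congr (fun n => ?_) h
  simp only [isingTwoPoint, spinMonomial_two]

/-- Eventually in the box size, all four points of a quadruple lie in `Λ_n`. [folklore] -/
theorem eventually_forall_mem_box_four (z : Fin 4 → Site 3) : ∀ᶠ n : ℕ in atTop, ∀ i, z i ∈ box 3 n :=
  eventually_all.2 fun i => eventually_mem_box (z i)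

/-- **Merging in the box from the screening dictionary**: if `z₀,…,z₃ ∈ Λ_n` and the mean screening of
`(z₂,z₃)` by the full duplicated cluster of `(z₀,z₁)` is `≤ 1 - c`, then
`U₄^{Λ_n}(z) + 2c ⟨σ_{z₀}σ_{z₁}⟩_{Λ_n}⟨σ_{z₂}σ_{z₃}⟩_{Λ_n} ≤ 0` (ADC21 (3.11) in the box,
`connectedFour_free_box_eq`, and Griffiths I). [cite: AizenmanDuminilCopinAnnals2021, eq. (3.11)] -/
theorem connectedFour_box_add_le_zero_of_meanScreening_le (hSI : ScreeningIdentity) {c : ℝ} {n : ℕ}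
    {z : Fin 4 → Site 3} (hz : ∀ i, z i ∈ box 3 n)
    (hms : meanScreening n n (z 0) (z 1) (z 2) (z 3) ≤ 1 - c) :
    connectedFour (isingMeasure (zdGraph 3) (box 3 n) (criticalBeta 3) 0 .free) spinAt z +
        2 * c * (isingTwoPoint (zdGraph 3) (box 3 n) (criticalBeta 3) 0 .free (z 0) (z 1) *
          isingTwoPoint (zdGraph 3) (box 3 n) (criticalBeta 3) 0 .free (z 2) (z 3)) ≤ 0 := by
  classical
  have hid := hSI n (z 0) (z 1) (z 2) (z 3) (hz 0) (hz 1) (hz 2) (hz 3)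
  have hP : c ≤ (sourcedDoubleCurrentLaw 3 n (criticalBeta 3) ({z 0} ∆ {z 1}) ({z 2} ∆ {z 3})).real
      (openConn (z 0) (z 2)) := by linarith
  have hz4 : z = ![z 0, z 1, z 2, z 3] := by funext i; fin_cases i <;> rfl
  have h4 := connectedFour_free_box_eq (d := 3) n (criticalBeta_nonneg 3) (hz 0) (hz 1) (hz 2) (hz 3)
  rw [← hz4] at h4
  have hG01 : 0 ≤ isingTwoPoint (zdGraph 3) (box 3 n) (criticalBeta 3) 0 .free (z 0) (z 1) :=
    isingTwoPoint_free_nonneg (fun {_ _ _ _ _} => GKSInequalities.gks_one_holds (zdGraph 3))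
      (criticalBeta_nonneg 3) (hz 0) (hz 1)
  have hG23 : 0 ≤ isingTwoPoint (zdGraph 3) (box 3 n) (criticalBeta 3) 0 .free (z 2) (z 3) :=
    isingTwoPoint_free_nonneg (fun {_ _ _ _ _} => GKSInequalities.gks_one_holds (zdGraph 3))
      (criticalBeta_nonneg 3) (hz 2) (hz 3)
  have hGG := mul_le_mul_of_nonneg_left hP (mul_nonneg hG01 hG23)
  rw [h4]
  nlinarith [hGG]

/-- **The limit form**: if the mean screening of `(z₂,z₃)` by the duplicated cluster of `(z₀,z₁)` is
`≤ 1 - c` for infinitely many box sizes, then the critical Ursell function satisfies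
`U₄(z) ≤ -2c ⟨σ_{z₀}σ_{z₁}⟩_{β_c}⟨σ_{z₂}σ_{z₃}⟩_{β_c}` (box limits of all terms; a convergent sequence
which is `≤ 0` frequently has limit `≤ 0`). [cite: AizenmanDuminilCopinAnnals2021, eq. (3.12)] -/
theorem criticalUrsellFour_le_of_frequently_meanScreening_le (hSI : ScreeningIdentity) {c : ℝ}
    (z : Fin 4 → Site 3)
    (hfreq : ∃ᶠ n : ℕ in atTop, meanScreening n n (z 0) (z 1) (z 2) (z 3) ≤ 1 - c) :
    criticalCorr 3 4 z - (criticalCorr 3 2 ![z 0, z 1] * criticalCorr 3 2 ![z 2, z 3]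
        + criticalCorr 3 2 ![z 0, z 2] * criticalCorr 3 2 ![z 1, z 3]
        + criticalCorr 3 2 ![z 0, z 3] * criticalCorr 3 2 ![z 1, z 2]) ≤
      -(2 * c * (criticalCorr 3 2 ![z 0, z 1] * criticalCorr 3 2 ![z 2, z 3])) := by
  have hU := tendsto_connectedFour_box_criticalBeta (d := 3) le_rfl z
  have hlim := hU.add (((tendsto_isingTwoPoint_box_criticalCorr_two (z 0) (z 1)).mul
    (tendsto_isingTwoPoint_box_criticalCorr_two (z 2) (z 3))).const_mul (2 * c))
  have hfreq' : ∃ᶠ n : ℕ in atTop,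
      connectedFour (isingMeasure (zdGraph 3) (box 3 n) (criticalBeta 3) 0 .free) spinAt z +
        2 * c * (isingTwoPoint (zdGraph 3) (box 3 n) (criticalBeta 3) 0 .free (z 0) (z 1) *
          isingTwoPoint (zdGraph 3) (box 3 n) (criticalBeta 3) 0 .free (z 2) (z 3)) ≤ 0 := by
    refine (hfreq.and_eventually (eventually_forall_mem_box_four z)).mono ?_
    rintro n ⟨hn, hbox⟩
    exact connectedFour_box_add_le_zero_of_meanScreening_le hSI hbox hn
  have hle := isClosed_Iic.mem_of_frequently_of_tendsto hfreq' hlim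
  rw [Set.mem_Iic] at hle
  linarith

/-- **Far screening is far merging** (the exact far end of the line): the screening dictionary
(ADC21 Lemma A.1, `ScreeningIdentity`) and far screening `≤ 1 - c` along dilations of one injective
shape (`FarScreeningIO`) give Aizenman's far merging `U₄(Ly) ≤ -2c ⟨σσ⟩⟨σσ⟩` along the same dilations,
i.e. `FarMergingShape cc2 (criticalCorr 3 4)` with constant `2c`. [cite: AizenmanDuminilCopinAnnals2021, eq. (3.11) and Appendix A, Lemma A.1] -/
theorem stub_farMerging : ScreeningIdentity → FarScreeningIO → FarMergingShape cc2 (criticalCorr 3 4) := by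
  rintro hSI ⟨c, hc, y, hy, hfar⟩
  refine ⟨2 * c, by positivity, y, hy, fun L₀ => ?_⟩
  obtain ⟨L, hL, hfreq⟩ := hfar L₀
  exact ⟨L, hL, criticalUrsellFour_le_of_frequently_meanScreening_le hSI (fun i => (L : ℤ) • y i) hfreq⟩

end Summit.CriticalPhenomena.Ising3DConformalLimit.EnergyNotSigmaSquaredGapForcesFarMerging

end
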